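import Mathlib.MeasureTheory.Integral.IntervalIntegral.FundThmCalculus
import Literature.Analysis.DeBrangesSpaces.Basic
import Summits.RiemannHypothesis.RiemannHypothesis.Theorems.SpectralTraceWindowTraceArchStubStructureFunctionAux2
import Summits.RiemannHypothesis.RiemannHypothesis.Theorems.SpectralTraceWindowTraceArchStubCausalCrystallisationAux
import HarnessLib

/-!
# The structure function of a configuration (`stub_structureFunction`)

Stub `stub_structureFunction` of the line `causal-level-sets` for the crux `WindowTraceArch`
(stmt-RiemannHypothesis-11195; skeleton
`Summit.RiemannHypothesis.RiemannHypothesis.Cruxes.WindowTraceArch.CausalLevelSets`).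

**Statement.** Let `γ, b : ℕ → ℝ` be a configuration of smeared atoms with widths
`δ ≤ b_k ≤ B` (`δ > 0`) and `Σ_k 1/(1 + γ_k²) < ∞`. Then there are an entire function `E`, a real
phase `φ`, a constant `C` and an exponent `N` such that: `E` is a Hermite–Biehler function
(`Literature.Analysis.DeBrangesSpaces.IsHermiteBiehler`); `E(z) ≠ 0` for `Im z ≥ -δ/2`;
`‖E'(z)/E(z)‖ ≤ C (1 + |z|)^N` for `Im z ≥ -δ/2`; `E(t) = |E(t)| e^{-iφ(t)}` for real `t`;
`-Im (E'(t)/E(t)) = Σ_k b_k/((t - γ_k)² + b_k²)` for real `t`; and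
`φ(v) - φ(u) = ∫ᵤᵛ Σ_k b_k/((t - γ_k)² + b_k²) dt`.

**Proof.** The witness is the (modified genus-one) canonical product over the zeros
`w_k = γ_k - i b_k`,
`E(z) = ∏_k (1 - z/w_k) e^{Re(1/w_k) z}`
(`= e^{-icz} ∏_k (1 - z/w_k)e^{z/w_k}`, `c = Σ_k b_k/|w_k|²`), built in the auxiliary files
`…StubStructureFunctionAux.lean` (locally uniform convergence from
`‖(1 - z/w)e^{Re(1/w)z} - 1‖ ≤ (3|z|² + B|z|)/|w|²` and `Σ 1/|w_k|² < ∞`; entireness; no zeros in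
`Im z > -δ`; `E'/E = Σ_k (1/(z - w_k) + Re(1/w_k))` by logarithmic differentiation of the partial
products and locally uniform limits) and `…StubStructureFunctionAux2.lean` (the Hermite–Biehler
inequality `|E(z̄)| < |E(z)|`, `Im z > 0`: each factor has modulus
`|w_k - z|/|w_k| e^{Re(1/w_k) Re z}` and `|w_k - z̄| < |w_k - z|`; the polynomial bound
`‖E'/E‖ ≤ (1 + 2/δ + B)(1 + δ⁻²)(Σ_k 1/(1+γ_k²))(1 + |z|)²` on `Im z ≥ -δ/2`), packaged as
`structFn_exists`. Here: on the real axis `Im (1/(t - w_k)) = -b_k/((t - γ_k)² + b_k²)` and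
`Re(1/w_k)` is real, so `-Im (E'/E)(t) = Σ_k b_k/((t - γ_k)² + b_k²)`; the phase is `φ = -θ` for
the continuous argument `θ` of `causalCLS_phase` (`E(t) = |E(t)| e^{iθ(t)}`, `θ' = Im (E'/E)`), and
the last identity is the fundamental theorem of calculus for the continuous derivative
`φ' = -Im (E'/E)`.

**Sources.** L. de Branges, *Hilbert Spaces of Entire Functions* (1968), §7 and Problem 28
(Hermite–Biehler class of products over zeros in the lower half-plane; phase functions);
B. Ya. Levin, *Lectures on Entire Functions* (1996), Lectures 4 and 27. All ingredients are proved
tree / Mathlib facts.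
-/

set_option linter.dupNamespace false

noncomputable section

open Complex Set MeasureTheory Filter
open scoped Real Topology

namespace Summit.RiemannHypothesis.RiemannHypothesis.Theorems.SpectralTraceWindowTraceArch

open Literature.NumberTheory.LFunctions
open Literature.Analysis.DeBrangesSpaces (IsHermiteBiehler sharp)

/-- **stub_structureFunction — the structure function of a configuration.** For a configuration
`(γ_k, b_k)` with `δ ≤ b_k ≤ B`, `δ > 0`, `Σ 1/(1+γ_k²) < ∞` there is a Hermite–Biehler function
`E` (the canonical product `∏_k (1 - z/w_k) e^{Re(1/w_k) z}` over the zeros `w_k = γ_k - i b_k`)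
with no zeros in `Im z ≥ -δ/2`, polynomially bounded `E'/E` there, a continuous phase `φ`
(`E(t) = |E(t)| e^{-iφ(t)}`), phase density `-Im (E'/E)(t) = Σ_k b_k/((t-γ_k)²+b_k²)` and
`φ(v) - φ(u) = ∫ᵤᵛ Σ_k b_k/((t-γ_k)²+b_k²) dt`. -/
theorem stub_structureFunction :
    ∀ (γ b : ℕ → ℝ) (δ B : ℝ), 0 < δ → (∀ k, δ ≤ b k ∧ b k ≤ B) →
      Summable (fun k => 1 / (1 + (γ k) ^ 2)) →
      ∃ (E : ℂ → ℂ) (φ : ℝ → ℝ) (C : ℝ) (N : ℕ), IsHermiteBiehler E ∧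
        (∀ z : ℂ, -(δ / 2) ≤ z.im → E z ≠ 0) ∧
        (∀ z : ℂ, -(δ / 2) ≤ z.im → ‖deriv E z / E z‖ ≤ C * (1 + ‖z‖) ^ N) ∧
        (∀ t : ℝ, E t = ((‖E t‖ : ℝ) : ℂ) * cexp (-(((φ t : ℝ) : ℂ) * I))) ∧
        (∀ t : ℝ, -(deriv E t / E t).im = ∑' k, b k / ((t - γ k) ^ 2 + (b k) ^ 2)) ∧
        (∀ u v : ℝ, φ v - φ u = ∫ t in u..v, ∑' k, b k / ((t - γ k) ^ 2 + (b k) ^ 2)) := by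
  intro γ b δ B hδ hb hγ
  -- the zeros `w_k = γ_k - i b_k`
  set w : ℕ → ℂ := fun k => (γ k : ℂ) - (b k : ℂ) * I with hw_def
  have hw_im : ∀ k, (w k).im = -b k := fun k => by simp [hw_def]
  have hw_re : ∀ k, (w k).re = γ k := fun k => by simp [hw_def]
  have hw : ∀ k, δ ≤ -(w k).im ∧ -(w k).im ≤ B := fun k => by
    rw [hw_im, neg_neg]
    exact hb k
  have hs : Summable fun k => 1 / (1 + (w k).re ^ 2) := by
    simpa only [hw_re] using hγ
  -- the structure function (canonical product) and its properties
  obtain ⟨E, hE, hne, hlog, hgrowth⟩ := structFn_exists w δ B hδ hw hs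
  have hreal : ∀ t : ℝ, -δ < ((t : ℂ)).im := fun t => by simp [hδ]
  have hE0 : ∀ t : ℝ, E t ≠ 0 := fun t => hne t (hreal t)
  -- the phase density on the real axis
  have hP : ∀ (k : ℕ) (t : ℝ), (((t : ℂ) - w k)⁻¹ + ((((w k)⁻¹).re : ℝ) : ℂ)).im =
      -(b k / ((t - γ k) ^ 2 + (b k) ^ 2)) := by
    intro k t
    rw [Complex.add_im, Complex.ofReal_im, add_zero, Complex.inv_im, Complex.normSq_apply,
      Complex.sub_re, Complex.sub_im, Complex.ofReal_re, Complex.ofReal_im, hw_re, hw_im]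
    have e : (0 : ℝ) - -b k = b k := by ring
    rw [e, neg_div, ← pow_two, ← pow_two]
  have hdens : ∀ t : ℝ, -(deriv E t / E t).im = ∑' k, b k / ((t - γ k) ^ 2 + (b k) ^ 2) := by
    intro t
    have h := Complex.hasSum_im (hlog t (hreal t))
    simp only [hP] at h
    have h2 := h.neg
    simp only [neg_neg] at h2
    exact h2.tsum_eq.symm
  -- the phase
  obtain ⟨θ, hθd, hθ⟩ := causalCLS_phase hE.differentiable hE0
  refine ⟨E, fun t => -θ t, (1 + 2 / δ + B) * (1 + (δ ^ 2)⁻¹) * (∑' k, 1 / (1 + (w k).re ^ 2)),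
    2, hE, fun z hz => hne z (by linarith), fun z hz => hgrowth z hz, fun t => ?_, hdens,
    fun u v => ?_⟩
  · -- polar form `E(t) = |E(t)| e^{-iφ(t)}`
    conv_lhs => rw [hθ t]
    congr 2
    push_cast
    ring
  · -- `φ(v) - φ(u) = ∫ᵤᵛ φ'`
    have hderiv : ∀ t : ℝ,
        HasDerivAt (fun s : ℝ => -θ s) (∑' k, b k / ((t - γ k) ^ 2 + (b k) ^ 2)) t := by
      intro t
      have h := (hθd t).neg
      rwa [hdens t] at h
    have hcont : Continuous fun t : ℝ => ∑' k, b k / ((t - γ k) ^ 2 + (b k) ^ 2) := by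
      have e : (fun t : ℝ => ∑' k, b k / ((t - γ k) ^ 2 + (b k) ^ 2)) =
          fun t : ℝ => -(deriv E t / E t).im := funext fun t => (hdens t).symm
      rw [e]
      have h1 : Continuous (deriv E) :=
        (hE.differentiable.contDiff (n := 1)).continuous_deriv le_rfl
      exact (Complex.continuous_im.comp ((h1.comp continuous_ofReal).div
        (hE.differentiable.continuous.comp continuous_ofReal) hE0)).neg
    rw [intervalIntegral.integral_eq_sub_of_hasDerivAt (fun t _ => hderiv t)
      (hcont.intervalIntegrable _ _)]

end Summit.RiemannHypothesis.RiemannHypothesis.Theorems.SpectralTraceWindowTraceArch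

end
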